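import Summits.CriticalPhenomena.PercolationContinuityZ3.Theorems.PercNearOneGluingNoHeavyLowerTailThreePartitionCensored

/-!
# `NoHeavyLowerTail` (crux stmt-CriticalPhenomena-4575): Conjecture V split into a COLUMN part and a ROW part —
# the row part is a theorem (Theorem A), the column part is a new single-cube statement ("shared Kleitman–Hall")

Support file (lineage `prim-bnk-2`, generation 27; `--supports stmt-CriticalPhenomena-4575`; memo
`run/shared/lean/prim/prim-l12/FROM-prim-bnk-2-g27-SHARED-CAPACITY.md`).  No `sorry`, standard axioms; the only unproved
statement is the `@[conjecture]`-tagged `ColumnSharedKleitmanHall`, used as an explicit hypothesis.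

Write the kernel of Conjecture V (`…ThreePartitionVOrder`, `vSumT`) in typed units (memo g23 §10),
`K = T1 + T2 + T3`, `T1 = [a∈𝒲]([a∈𝒱]−[c∈𝒱])`, `T2 = [a∈𝒱]([a∈𝒲]−[c∈𝒲])`, `T3 = [c∈𝒱]([b∈𝒲]−[c∈𝒲])`, and let
`D = (a∈𝒱𝒲 | · | c∉𝒱, c∉𝒲)` be the double faces (`K = +2`).  This file records the decomposition
  `vSumT = colPart + rowPart`,  `colPart = T1 + T2 − 1_D` (pure column units),  `rowPart = T3 + 1_D`,
(`vSumT_eq_colPart_add_rowPart`) and proves: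
* **`rowPart_nonneg`** — the ROW HALF of Conjecture V is a theorem: `T3 + 1_D` is up-set-nonnegative for all up-sets
  `𝒱, 𝒲`, every twist and every copy-order up-set `𝒳`.  It is Theorem A (`triT_robust_le_b`, generation 25) with source side `b`,
  `G = 𝒱∩𝒲`, `H = 𝒲` and the side function `σ(c) = b ⟺ c ∈ 𝒱`; the targets `(·|𝒲∖𝒱|𝒱∖𝒲)` are spare.
* **`colPart_add_cross_nonneg_of`** — the COLUMN HALF: under the new single-cube statement `ColumnSharedKleitmanHall`
  (this work, OPEN, census below) `colPart + 1_X ≥ 0`, where `X = (a∈𝒱∖𝒲 | · | c∈𝒲∖𝒱)` is the "crossing class" of `T2⁻` units.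
So Conjecture V is EQUIVALENT to absorbing the crossing class `X` (`N_×` units; `|X| = |(·|𝒲∖𝒱|𝒱∖𝒲)|`, the spare row targets)
jointly by the two halves; computationally (memo §2, `m ≤ 4` exhaustive, `m = 5, 6` sampled) there is always a routing in which every
`X` unit takes either a column unit or the row unit of a double face, every other column source a column unit and every `T3⁻` a row
unit (discipline `(DX)`), but no fixed or pattern-local split of `X` works — the crossing class is the whole interaction between
Kleitman's world (columns) and Theorem A's world (rows). [this work]
-/

namespace Summit.CriticalPhenomena.PercolationContinuityZ3.Theorems.ThreePartition

open Finset Function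
open scoped Classical

noncomputable section

variable {ι : Type*} [Fintype ι]

/-! ## The two halves -/

/-- **Column part** of the kernel sum: `T1 + T2 − 1_D` summed over the faces with `(a,b) ∈ 𝒳`, i.e.
`2·#(a∈𝒱𝒲) − #(a∈𝒲, c∈𝒱) − #(a∈𝒱, c∈𝒲) − #(a∈𝒱𝒲, c∉𝒱, c∉𝒲)` (all units of the form `[a∈·][c∈·]`: they live in
columns `b = const`, which are cubes). [this work] -/
def colPart (τ : Set ι) (𝒱 𝒲 : Set (Set ι)) (𝒳 : Set (Set ι × Set ι)) : ℤ :=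
  2 * (triT τ (fun a b _ => (a, b) ∈ 𝒳 ∧ a ∈ 𝒱 ∧ a ∈ 𝒲) : ℤ)
    - (triT τ (fun a b c => (a, b) ∈ 𝒳 ∧ a ∈ 𝒲 ∧ c ∈ 𝒱) + triT τ (fun a b c => (a, b) ∈ 𝒳 ∧ a ∈ 𝒱 ∧ c ∈ 𝒲)
        + triT τ (fun a b c => (a, b) ∈ 𝒳 ∧ (a ∈ 𝒱 ∧ a ∈ 𝒲) ∧ c ∉ 𝒱 ∧ c ∉ 𝒲) : ℕ)

/-- **Row part** of the kernel sum: `T3 + 1_D`, i.e. `#(c∈𝒱, b∈𝒲) − #(c∈𝒱𝒲) + #(a∈𝒱𝒲, c∉𝒱, c∉𝒲)`. [this work] -/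
def rowPart (τ : Set ι) (𝒱 𝒲 : Set (Set ι)) (𝒳 : Set (Set ι × Set ι)) : ℤ :=
  (triT τ (fun a b c => (a, b) ∈ 𝒳 ∧ c ∈ 𝒱 ∧ b ∈ 𝒲)
      + triT τ (fun a b c => (a, b) ∈ 𝒳 ∧ (a ∈ 𝒱 ∧ a ∈ 𝒲) ∧ c ∉ 𝒱 ∧ c ∉ 𝒲) : ℕ)
    - (triT τ (fun a b c => (a, b) ∈ 𝒳 ∧ c ∈ 𝒱 ∧ c ∈ 𝒲) : ℤ)

/-- `vSumT = colPart + rowPart` (the double-face term cancels). [this work] -/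
theorem vSumT_eq_colPart_add_rowPart (τ : Set ι) (𝒱 𝒲 : Set (Set ι)) (𝒳 : Set (Set ι × Set ι)) :
    vSumT τ 𝒱 𝒲 𝒳 = colPart τ 𝒱 𝒲 𝒳 + rowPart τ 𝒱 𝒲 𝒳 := by
  unfold vSumT colPart rowPart
  push_cast
  ring

/-! ## The row half is a theorem -/

/-- **The row half of Conjecture V holds**: `T3 + 1_D` is up-set-nonnegative, i.e.
`#(c∈𝒱𝒲, b∉𝒲) ≤ #(c∈𝒱∖𝒲, b∈𝒲) + #(a∈𝒱𝒲, c∉𝒱∪𝒲)` on every copy-order up-set `𝒳`, every twist.  Proof: Theorem A with source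
side `b`, `G = 𝒱∩𝒲`, `H = 𝒲`, `σ(c) = [c ∈ 𝒱]` routes the `T3⁻` units `(·|¬𝒲|𝒱𝒲)` perfectly onto `(·|𝒱𝒲|𝒱∖𝒲) ⊔ D`, a subset of
the available targets. [this work] -/
theorem rowPart_nonneg (τ : Set ι) {𝒱 𝒲 : Set (Set ι)} {𝒳 : Set (Set ι × Set ι)}
    (h𝒱 : IsUpperSet 𝒱) (h𝒲 : IsUpperSet 𝒲) (h𝒳 : IsUpperSet 𝒳) : 0 ≤ rowPart τ 𝒱 𝒲 𝒳 := by
  -- Theorem A, side b, G = 𝒱 ∩ 𝒲, H = 𝒲, σ = [· ∈ 𝒱]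
  have hA := triT_robust_le_b τ h𝒳 (h𝒱.inter h𝒲) h𝒲 (fun c => decide (c ∈ 𝒱))
  have eN : triT τ (fun a b c => (a, b) ∈ 𝒳 ∧ c ∈ 𝒱 ∩ 𝒲 ∧ b ∉ 𝒲) =
      triT τ (fun a b c => ((a, b) ∈ 𝒳 ∧ c ∈ 𝒱 ∧ c ∈ 𝒲) ∧ ¬ b ∈ 𝒲) :=
    triT_congr fun a b c => by simp only [Set.mem_inter_iff, and_assoc]
  -- split Theorem A's targets by the layer test `c ∈ 𝒱`
  have sA := triT_and_add_triT_and_not τ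
    (fun a b c => (a, b) ∈ 𝒳 ∧ c ∉ 𝒲 ∧ (if decide (c ∈ 𝒱) then b ∈ 𝒱 ∩ 𝒲 else a ∈ 𝒱 ∩ 𝒲)) (fun _ _ c => c ∈ 𝒱)
  have hP1 : triT τ (fun a b c => ((a, b) ∈ 𝒳 ∧ c ∉ 𝒲 ∧ (if decide (c ∈ 𝒱) then b ∈ 𝒱 ∩ 𝒲 else a ∈ 𝒱 ∩ 𝒲)) ∧ c ∈ 𝒱) ≤
      triT τ (fun a b c => ((a, b) ∈ 𝒳 ∧ c ∈ 𝒱 ∧ b ∈ 𝒲) ∧ ¬ c ∈ 𝒲) :=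
    triT_mono τ fun a b c h => by
      obtain ⟨⟨hx, hcW, hif⟩, hcV⟩ := h
      simp only [hcV, decide_true, if_true, Set.mem_inter_iff] at hif
      exact ⟨⟨hx, hcV, hif.2⟩, hcW⟩
  have hP2 : triT τ (fun a b c => ((a, b) ∈ 𝒳 ∧ c ∉ 𝒲 ∧ (if decide (c ∈ 𝒱) then b ∈ 𝒱 ∩ 𝒲 else a ∈ 𝒱 ∩ 𝒲)) ∧ ¬ c ∈ 𝒱) ≤
      triT τ (fun a b c => (a, b) ∈ 𝒳 ∧ (a ∈ 𝒱 ∧ a ∈ 𝒲) ∧ c ∉ 𝒱 ∧ c ∉ 𝒲) :=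
    triT_mono τ fun a b c h => by
      obtain ⟨⟨hx, hcW, hif⟩, hcV⟩ := h
      simp only [hcV, decide_false, Set.mem_inter_iff] at hif
      exact ⟨hx, hif, hcV, hcW⟩
  -- bookkeeping of the row part
  have s1 := triT_and_add_triT_and_not τ (fun a b c => (a, b) ∈ 𝒳 ∧ c ∈ 𝒱 ∧ b ∈ 𝒲) (fun _ _ c => c ∈ 𝒲)
  have s2 := triT_and_add_triT_and_not τ (fun a b c => (a, b) ∈ 𝒳 ∧ c ∈ 𝒱 ∧ c ∈ 𝒲) (fun _ b _ => b ∈ 𝒲)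
  have e12 : triT τ (fun a b c => ((a, b) ∈ 𝒳 ∧ c ∈ 𝒱 ∧ b ∈ 𝒲) ∧ c ∈ 𝒲) =
      triT τ (fun a b c => ((a, b) ∈ 𝒳 ∧ c ∈ 𝒱 ∧ c ∈ 𝒲) ∧ b ∈ 𝒲) :=
    triT_congr fun a b c => by tauto
  rw [eN] at hA
  rw [e12] at s1
  unfold rowPart
  push_cast
  have hA' := Int.ofNat_le.2 hA
  have hP1' := Int.ofNat_le.2 hP1
  have hP2' := Int.ofNat_le.2 hP2
  have s1' := congrArg (fun n : ℕ => (n : ℤ)) s1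
  have s2' := congrArg (fun n : ℕ => (n : ℤ)) s2
  have sA' := congrArg (fun n : ℕ => (n : ℤ)) sA
  simp only [Nat.cast_add] at hA' hP1' hP2' s1' s2' sA'
  linarith

/-- **Conjecture V ⟺ the column part alone absorbs what the row part leaves**: since `rowPart ≥ 0` unconditionally,
`colPart ≥ 0` on `𝒳` already gives `vSumT ≥ 0` there. (Not true for every `𝒳`: `colPart` can be negative — see
`ColumnSharedKleitmanHall` for what is conjectured about it.) [this work] -/
theorem vSumT_nonneg_of_colPart_nonneg (τ : Set ι) {𝒱 𝒲 : Set (Set ι)} {𝒳 : Set (Set ι × Set ι)}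
    (h𝒱 : IsUpperSet 𝒱) (h𝒲 : IsUpperSet 𝒲) (h𝒳 : IsUpperSet 𝒳) (hcol : 0 ≤ colPart τ 𝒱 𝒲 𝒳) :
    0 ≤ vSumT τ 𝒱 𝒲 𝒳 := by
  rw [vSumT_eq_colPart_add_rowPart]
  exact add_nonneg hcol (rowPart_nonneg τ h𝒱 h𝒲 h𝒳)

/-! ## The column half: the shared Kleitman–Hall statement -/

/-- **SHARED KLEITMAN–HALL** (this work; OPEN).  For all up-sets `𝒱, 𝒲`, every twist and every copy-order up-set `𝒳`:
  `#(a∈𝒲∖𝒱 | · | c∈𝒱) + #(a∈𝒱∖𝒲 | · | c∈𝒱𝒲) ≤ #(a∈𝒱𝒲 | · | c∉𝒱𝒲)`,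
i.e. the `T1⁻` units and the `T2⁻` units outside the crossing class `X = (a∈𝒱∖𝒲|·|c∈𝒲∖𝒱)` inject upward into the column
targets `(𝒱𝒲|·|¬𝒱𝒲)` with ONE unit per face.  Each column `b = const` is a cube `2^R` with `a ↔ c` complementary, where the
statement reads, for up-sets `U, B = 𝒱, C = 𝒲` of `2^R` and `σX = {x : R∖x ∈ X}`:
  `|U ∩ B∩C ∖ σ(B∩C)| ≥ |U ∩ (C∖B) ∩ σB| + |U ∩ (B∖C) ∩ σ(B∩C)|`
("Kleitman–Hall for `B∩C` with the bottom class `(¬B¬C|·|BC)` swapped for the crossing class `(C∖B|·|B∖C)`").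
Census (memo §1, `code/g27/claim2*.c`): all up-set triples `(U,B,C)` of `2^n`, `n ≤ 4` (4 741 632), `n = 5, 6` (8·10⁶ random),
the 4-parameter section-closed class `Bz ⊆ Bx, Cz ⊆ Cx` (`n ≤ 3` exhaustive, `n ≤ 6` sampled), and this `triT` form for ALL
twists, `m ≤ 4` exhaustive over `(𝒱,𝒲,τ)` (451 584 instances, `twistcheck.c`): `0` failures; it is NOT a
nonnegative combination of Kleitman/four-functions instances at the profile level (LP, `cone3.c`), the typed variant is false, and the
containment matrix always has full row rank.  An obligation of our theories, never a fact: use as `(h : ColumnSharedKleitmanHall)`.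
[status: open] -/
@[conjecture] def ColumnSharedKleitmanHall : Prop :=
  ∀ (ι : Type) [Fintype ι] (τ : Set ι) (𝒱 𝒲 : Set (Set ι)) (𝒳 : Set (Set ι × Set ι)),
    IsUpperSet 𝒱 → IsUpperSet 𝒲 → IsUpperSet 𝒳 →
      triT τ (fun a b c => (a, b) ∈ 𝒳 ∧ (a ∈ 𝒲 ∧ a ∉ 𝒱) ∧ c ∈ 𝒱)
          + triT τ (fun a b c => (a, b) ∈ 𝒳 ∧ (a ∈ 𝒱 ∧ a ∉ 𝒲) ∧ c ∈ 𝒱 ∧ c ∈ 𝒲)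
        ≤ triT τ (fun a b c => (a, b) ∈ 𝒳 ∧ (a ∈ 𝒱 ∧ a ∈ 𝒲) ∧ ¬ (c ∈ 𝒱 ∧ c ∈ 𝒲))

/-- **The column half under shared Kleitman–Hall**: `colPart + #X ≥ 0`, `X = (a∈𝒱∖𝒲 | · | c∈𝒲∖𝒱)` the crossing class —
the identity `colPart + 1_X = (𝒱𝒲|·|¬𝒱𝒲) − (𝒲∖𝒱|·|𝒱) − (𝒱∖𝒲|·|𝒱𝒲)` (one inclusion–exclusion on the double faces) plus the
conjecture. [this work] -/
theorem colPart_add_cross_nonneg_of (h : ColumnSharedKleitmanHall) {ι : Type} [Fintype ι] (τ : Set ι)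
    {𝒱 𝒲 : Set (Set ι)} {𝒳 : Set (Set ι × Set ι)} (h𝒱 : IsUpperSet 𝒱) (h𝒲 : IsUpperSet 𝒲) (h𝒳 : IsUpperSet 𝒳) :
    0 ≤ colPart τ 𝒱 𝒲 𝒳 + triT τ (fun a b c => (a, b) ∈ 𝒳 ∧ (a ∈ 𝒱 ∧ a ∉ 𝒲) ∧ c ∈ 𝒲 ∧ c ∉ 𝒱) := by
  have hC := h ι τ 𝒱 𝒲 𝒳 h𝒱 h𝒲 h𝒳
  -- the two mixed counts of `colPart`, split by the test on copy `a`
  have s1 := triT_and_add_triT_and_not τ (fun a b c => (a, b) ∈ 𝒳 ∧ a ∈ 𝒲 ∧ c ∈ 𝒱) (fun a _ _ => a ∈ 𝒱)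
  have e1 : triT τ (fun a b c => ((a, b) ∈ 𝒳 ∧ a ∈ 𝒲 ∧ c ∈ 𝒱) ∧ a ∈ 𝒱) =
      triT τ (fun a b c => ((a, b) ∈ 𝒳 ∧ a ∈ 𝒱 ∧ a ∈ 𝒲) ∧ c ∈ 𝒱) := triT_congr fun a b c => by tauto
  have e1' : triT τ (fun a b c => ((a, b) ∈ 𝒳 ∧ a ∈ 𝒲 ∧ c ∈ 𝒱) ∧ ¬ a ∈ 𝒱) =
      triT τ (fun a b c => (a, b) ∈ 𝒳 ∧ (a ∈ 𝒲 ∧ a ∉ 𝒱) ∧ c ∈ 𝒱) := triT_congr fun a b c => by tauto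
  have s2 := triT_and_add_triT_and_not τ (fun a b c => (a, b) ∈ 𝒳 ∧ a ∈ 𝒱 ∧ c ∈ 𝒲) (fun a _ _ => a ∈ 𝒲)
  have e2 : triT τ (fun a b c => ((a, b) ∈ 𝒳 ∧ a ∈ 𝒱 ∧ c ∈ 𝒲) ∧ a ∈ 𝒲) =
      triT τ (fun a b c => ((a, b) ∈ 𝒳 ∧ a ∈ 𝒱 ∧ a ∈ 𝒲) ∧ c ∈ 𝒲) := triT_congr fun a b c => by tauto
  -- the `T2⁻` units outside `𝒲` on copy `a`, split by the layer test `c ∈ 𝒱` (rest vs. crossing class)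
  have s3 := triT_and_add_triT_and_not τ (fun a b c => ((a, b) ∈ 𝒳 ∧ a ∈ 𝒱 ∧ c ∈ 𝒲) ∧ ¬ a ∈ 𝒲) (fun _ _ c => c ∈ 𝒱)
  have e3 : triT τ (fun a b c => (((a, b) ∈ 𝒳 ∧ a ∈ 𝒱 ∧ c ∈ 𝒲) ∧ ¬ a ∈ 𝒲) ∧ c ∈ 𝒱) =
      triT τ (fun a b c => (a, b) ∈ 𝒳 ∧ (a ∈ 𝒱 ∧ a ∉ 𝒲) ∧ c ∈ 𝒱 ∧ c ∈ 𝒲) := triT_congr fun a b c => by tauto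
  have e3' : triT τ (fun a b c => (((a, b) ∈ 𝒳 ∧ a ∈ 𝒱 ∧ c ∈ 𝒲) ∧ ¬ a ∈ 𝒲) ∧ ¬ c ∈ 𝒱) =
      triT τ (fun a b c => (a, b) ∈ 𝒳 ∧ (a ∈ 𝒱 ∧ a ∉ 𝒲) ∧ c ∈ 𝒲 ∧ c ∉ 𝒱) := triT_congr fun a b c => by tauto
  -- the `(a ∈ 𝒱𝒲)` count: split by `c ∈ 𝒱`, its `c ∉ 𝒱` part by `c ∈ 𝒲`; and split by `c ∈ 𝒲`
  have s4 := triT_and_add_triT_and_not τ (fun a b _ => (a, b) ∈ 𝒳 ∧ a ∈ 𝒱 ∧ a ∈ 𝒲) (fun _ _ c => c ∈ 𝒱)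
  have s5 := triT_and_add_triT_and_not τ (fun a b c => ((a, b) ∈ 𝒳 ∧ a ∈ 𝒱 ∧ a ∈ 𝒲) ∧ ¬ c ∈ 𝒱) (fun _ _ c => c ∈ 𝒲)
  have e5 : triT τ (fun a b c => (((a, b) ∈ 𝒳 ∧ a ∈ 𝒱 ∧ a ∈ 𝒲) ∧ ¬ c ∈ 𝒱) ∧ ¬ c ∈ 𝒲) =
      triT τ (fun a b c => (a, b) ∈ 𝒳 ∧ (a ∈ 𝒱 ∧ a ∈ 𝒲) ∧ c ∉ 𝒱 ∧ c ∉ 𝒲) := triT_congr fun a b c => by tauto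
  have s6 := triT_and_add_triT_and_not τ (fun a b _ => (a, b) ∈ 𝒳 ∧ a ∈ 𝒱 ∧ a ∈ 𝒲) (fun _ _ c => c ∈ 𝒲)
  -- the target count of the conjecture, split by `c ∈ 𝒲`
  have s8 := triT_and_add_triT_and_not τ (fun a b c => (a, b) ∈ 𝒳 ∧ (a ∈ 𝒱 ∧ a ∈ 𝒲) ∧ ¬ (c ∈ 𝒱 ∧ c ∈ 𝒲))
    (fun _ _ c => c ∈ 𝒲)
  have e8 : triT τ (fun a b c => ((a, b) ∈ 𝒳 ∧ (a ∈ 𝒱 ∧ a ∈ 𝒲) ∧ ¬ (c ∈ 𝒱 ∧ c ∈ 𝒲)) ∧ c ∈ 𝒲) =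
      triT τ (fun a b c => (((a, b) ∈ 𝒳 ∧ a ∈ 𝒱 ∧ a ∈ 𝒲) ∧ ¬ c ∈ 𝒱) ∧ c ∈ 𝒲) := triT_congr fun a b c => by tauto
  have e8' : triT τ (fun a b c => ((a, b) ∈ 𝒳 ∧ (a ∈ 𝒱 ∧ a ∈ 𝒲) ∧ ¬ (c ∈ 𝒱 ∧ c ∈ 𝒲)) ∧ ¬ c ∈ 𝒲) =
      triT τ (fun a b c => ((a, b) ∈ 𝒳 ∧ a ∈ 𝒱 ∧ a ∈ 𝒲) ∧ ¬ c ∈ 𝒲) := triT_congr fun a b c => by tauto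
  rw [e1, e1'] at s1
  rw [e2] at s2
  rw [e3, e3'] at s3
  rw [e5] at s5
  rw [e8, e8'] at s8
  unfold colPart
  push_cast
  have hC' := Int.ofNat_le.2 hC
  have s1' := congrArg (fun n : ℕ => (n : ℤ)) s1
  have s2' := congrArg (fun n : ℕ => (n : ℤ)) s2
  have s3' := congrArg (fun n : ℕ => (n : ℤ)) s3
  have s4' := congrArg (fun n : ℕ => (n : ℤ)) s4
  have s5' := congrArg (fun n : ℕ => (n : ℤ)) s5
  have s6' := congrArg (fun n : ℕ => (n : ℤ)) s6
  have s8' := congrArg (fun n : ℕ => (n : ℤ)) s8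
  simp only [Nat.cast_add] at hC' s1' s2' s3' s4' s5' s6' s8'
  linarith

end

end Summit.CriticalPhenomena.PercolationContinuityZ3.Theorems.ThreePartition
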